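import Literature.Combinatorics.LorentzianPolynomials.RayleighSupportIntervalConvex
import HarnessLib

/-!
# The support of a homogeneous `c`-Rayleigh polynomial is M-convex (Brändén–Huh 2020, §2.4 Lemma 2.21, Lemma 2.22 (2),
# Theorem 2.23)

Layer `Literature/Combinatorics/LorentzianPolynomials`, namespace `Literature.Combinatorics.LorentzianPolynomials`;
lane `lit-hodgefound` (Track 2 foundations library), seat p16, generation 29 (row g29-#2). Builds on
`RayleighSupportIntervalConvex.lean` (row g29-#1: Lemma 2.22 (1) `isIntervalConvex_support_of_isCRayleigh`, the support
calculus `coeff_iterPderiv_ne_zero_iff`, Def. 2.18 at `w = 0`), `RayleighOperations.lean` (Lemma 2.20: contractions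
`IsCRayleigh.pderiv`/`.iterPderiv`, translations `IsCRayleigh.translate`), `Basic.lean` (`IsMConvex`, the exchange
property) and `Substitution.lean` (`IsMConvex.sep_apply_eq_zero`, coordinate faces of M-convex sets).

## Source (verbatim) — P. Brändén, J. Huh, *Lorentzian polynomials* [BrandenHuh2019] (held `paper:arxiv-1902.03719`)

§2.4 (pp. 19–20): "The goal of this section is to show that the support of any homogeneous `c`-Rayleigh polynomial is
M-convex (Theorem 2.23). The notion of M♮-convexity will be useful for the proof: A subset `J♮ ⊆ ℕ^n` is said to be
M♮-convex if there is an M-convex set `J` in `ℕ^{n+1}` such that `J♮ = {(α_1, …, α_n) | (α_1, …, α_n, α_{n+1}) ∈ J}`.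
The projection from `J` to `J♮` should be bijective for any such `J`, as the M-convexity of `J` implies that `J` is in
`Δ^d_n` for some `d`. […] The *augmentation property* for `J♮ ⊆ ℕ^n` is the implication
`(α ∈ J♮, β ∈ J♮, |α|_1 < |β|_1) ⟹ (α_j < β_j and α + e_j ∈ J♮ for some j ∈ [n])`.
**Lemma 2.21.** Let `J♮` be an interval convex subset of `ℕ^n` containing `0`. Then `J♮` is M♮-convex if and only if
`J♮` satisfies the augmentation property. […] *Proof.* Let `d` be any sufficiently large positive integer, and set
`J = {(α_1, …, α_n, d - α_1 - ⋯ - α_n) ∈ ℕ^{n+1} | (α_1, …, α_n) ∈ J♮}`. The "only if" direction is straightforward: If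
`J♮` is M♮-convex, then `J` is M-convex, and the augmentation property for `J♮` is a special case of the exchange
property for `J`. We prove the "if" direction by checking the exchange property for `J`. Let `α` and `β` be elements of
`J`, and let `i` be an index satisfying `α_i > β_i`. We claim that there is an index `j` satisfying `α_j < β_j` and
`α - e_i + e_j ∈ J`. By the augmentation property for `J♮`, it is enough to justify the claim when `i ≠ n + 1`. When
`α_{n+1} < β_{n+1}`, then we may take `j = n + 1` […]. Suppose `α_{n+1} ≥ β_{n+1}`. In this case, we consider the
element `γ = α - e_i + e_{n+1}`. The element `γ` belongs to `J`, because `J♮` is an interval convex set containing `0`.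
We have `γ_{n+1} > β_{n+1}`, and hence the augmentation property for `J♮` gives an index `j` satisfying `γ_j < β_j` and
`α - e_i + e_j = γ - e_{n+1} + e_j ∈ J`. This index `j` is necessarily different from `i` because `α_i > β_i`. It
follows that `α_j = γ_j < β_j`, and the M-convexity of `J` is proved."
(p. 21) "**Lemma 2.22.** Let `f` be a `c`-Rayleigh polynomial in `ℝ[w_1, …, w_n]`. (1) The support of `f` is interval
convex. (2) If `f(0)` is nonzero, then `supp(f)` is M♮-convex." (p. 22, proof of (2)) "Suppose `f` is a counterexample
to (2) that is minimal with respect to the degree and the number of variables of `f`. By Lemma 2.21 and (1) of the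
current lemma, we know that the support of `f` fails to have the augmentation property. In other words, there are `α`
and `β` in the support of `f` such that `|α|_1 < |β|_1` and, for all `i`, `α_i < β_i ⟹ α + e_i ∉ supp(f)`. We may and
will suppose that `|α|_1` is minimal among all such `α` and `β` for the polynomial `f`. For any `γ`, write `S(γ)` for
the set of indices `i` such that `γ_i > 0`. If `i` is in the intersection of `S(α)` and `S(β)`, then `∂_i f` is a
counterexample to (2) that has degree less than that of `f`, and hence `S(α) ∩ S(β) = ∅`. […] Since `supp(f)` is
interval convex by (1), there is an index `i` in `S(α)`. In addition, since `f(0)` is nonzero, we have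
`α - e_i ∈ supp(f)`. The vectors `α - e_i` and `β` satisfy the augmentation property for `supp(f)`, by the minimality of
`|α|_1`. Therefore, there is an index `j` such that `(α - e_i)_j < β_j` and `α - e_i + e_j ∈ supp(f)`. The first
condition shows that the index `j` cannot be in `S(α)`, so it must be in `S(β)`. The vectors `α - e_i + e_j` and `β`
satisfy the augmentation property for `supp(f)`, since otherwise `∂_j f` is a smaller counterexample to (2).
Therefore, there is an index `k` such that `(α - e_i + e_j)_k < β_k` and `α - e_i + e_j + e_k ∈ supp(f)`. […] the
failure of the augmentation property for `α` and `β` implies `α + e_j ∉ supp(f)` and `α + e_k ∉ supp(f)`. Note that the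
`c`-Rayleigh polynomial `g := ∂^{α-e_i} f` satisfies `e_i, e_j + e_k ∈ supp(g)` and `e_i + e_j, e_i + e_k ∉ supp(g)`.
The first pair of conditions shows that `g(w) ∂_j∂_k g(w)` is a strictly increasing function of `w_i` if we set all the
variables other than `w_i` equal to `1`. On the other hand, the second pair of conditions shows that
`∂_j g(w) ∂_k g(w)` is independent of `w_i`, by the interval convexity of `supp(g)`. This contradicts the `c`-Rayleigh
property of `g`, proving (2)."
(p. 23) "**Theorem 2.23.** If `f` is homogeneous and `c`-Rayleigh, then the support of `f` is M-convex. *Proof.* By (5)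
of Lemma 2.20 and (2) of Lemma 2.22, the support of the translation `g(w_1, …, w_n) = f(w_1 + 1, …, w_n + 1)` is
M♮-convex. In other words, the support `J` of the homogenization of `g` is M-convex. Since the intersection of an
M-convex set with a coordinate hyperplane is M-convex, this implies the M-convexity of the support of `f`."

## What is here

* §1 `HasAugmentationProperty J`, `IsMNatConvex J` (projection `Finsupp.some` of an M-convex subset of
  `ℕ^{n+1} = Option σ →₀ ℕ`), the homogenization `homogenization d J = {α' | α'|_σ ∈ J, |α'| = d}` and its lifts
  `α ↦ α.optionElim (d - |α|)`; `IsMConvex.degree_le_degree` ("`J` is in `Δ^d_n` for some `d`").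
* §2 **Lemma 2.21**: `isMConvex_homogenization` (the "if" direction, verbatim; for every `d` — only the identification
  `J♮ = some '' J` needs `d ≥ sup |J♮|`), `IsMNatConvex.hasAugmentationProperty` ("only if"),
  `isMNatConvex_iff_hasAugmentationProperty` (for bounded `J♮`, which the source's `J♮ = supp f` are).
* §3 **Lemma 2.22 (2)**: the final contradiction `coeff_add_single_ne_zero_or_of_isCRayleigh` (`0, e_i, e_j + e_k ∈ supp g`
  force `e_i + e_j ∈ supp g` or `e_i + e_k ∈ supp g`: evaluate Def. 2.18 at `(1, …, t, …, 1)`, `t` large), the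
  augmentation property `exists_lt_coeff_add_single_ne_zero_of_isCRayleigh` (the printed argument as a strong induction on
  `|α| + |β|`; its reductions are the contractions `∂_i f`, `∂_j f` and the pair `(α - e_i, β)`, so the source's
  minimality in the number of variables is not needed), `hasAugmentationProperty_support_of_isCRayleigh`,
  **`isMNatConvex_support_of_isCRayleigh`** (Lemma 2.22 (2) as printed).
* §4 **Theorem 2.23** `isMConvex_support_of_isCRayleigh`: the normalized coefficients of the translation
  `c_δ(f(w + a)) = (∂^δ f)(a)` (Taylor), hence `supp f(w+𝟙) = {δ | δ ≤ γ for some γ ∈ supp f}`; the homogenization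
  of `supp f(w+𝟙)` is M-convex (§§2–3), its face `α_{n+1} = 0` is `supp f`, and faces / pull-backs of M-convex sets
  are M-convex.

Three definitions with bodies (`HasAugmentationProperty`, `IsMNatConvex`, `homogenization`), theorems otherwise; no
`sorry`, no named fact. The second sentence of Lemma 2.21 (independent sets of matroids) is not restated here; cf.
`IndependentSets.lean` (`isMConvex_indepExp`).

## References

* [BrandenHuh2019] P. Brändén, J. Huh, *Lorentzian polynomials*, Ann. of Math. (2) 192 (2020) 821–891, arXiv:1902.03719 —
  §2.4 (M♮-convexity, augmentation property, pp. 19–20), Lemma 2.21 (pp. 20–21), Lemma 2.22 (2) (pp. 21–23), Theorem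
  2.23 (p. 23), Lemma 2.20 (1), (5).
* [Murota2003] K. Murota, *Discrete convex analysis*, SIAM (2003) — §4.7 (M♮-convex sets), as cited loc. cit.
-/

noncomputable section

open MvPolynomial Finsupp Finset

namespace Literature.Combinatorics.LorentzianPolynomials

variable {σ : Type*}

/-! ## §1 The augmentation property, M♮-convex sets, homogenization -/

section Defs

/-- **The augmentation property** for `J♮ ⊆ ℕ^n`: "the implication
`(α ∈ J♮, β ∈ J♮, |α|_1 < |β|_1) ⟹ (α_j < β_j and α + e_j ∈ J♮ for some j ∈ [n])`."
[cite: BrandenHuh2019, §2.4 (p. 20, before Lemma 2.21)] -/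
def HasAugmentationProperty (J : Set (σ →₀ ℕ)) : Prop :=
  ∀ ⦃α β : σ →₀ ℕ⦄, α ∈ J → β ∈ J → α.degree < β.degree → ∃ j, α j < β j ∧ α + Finsupp.single j 1 ∈ J

/-- Unfolding the augmentation property. [cite: BrandenHuh2019, §2.4 (p. 20)] -/
theorem hasAugmentationProperty_iff (J : Set (σ →₀ ℕ)) :
    HasAugmentationProperty J ↔
      ∀ ⦃α β : σ →₀ ℕ⦄, α ∈ J → β ∈ J → α.degree < β.degree → ∃ j, α j < β j ∧ α + Finsupp.single j 1 ∈ J :=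
  Iff.rfl

/-- **M♮-convex sets**: "A subset `J♮ ⊆ ℕ^n` is said to be M♮-convex if there is an M-convex set `J` in `ℕ^{n+1}`
such that `J♮ = {(α_1, …, α_n) | (α_1, …, α_n, α_{n+1}) ∈ J}`" — here `ℕ^{n+1} = Option σ →₀ ℕ` (the extra coordinate
is `none`) and the projection is Mathlib's `Finsupp.some`. [cite: BrandenHuh2019, §2.4 (p. 19)] [cite: Murota2003,
§4.7] -/
def IsMNatConvex (J : Set (σ →₀ ℕ)) : Prop :=
  ∃ J' : Set (Option σ →₀ ℕ), IsMConvex J' ∧ Finsupp.some '' J' = J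

/-- Unfolding M♮-convexity. [cite: BrandenHuh2019, §2.4 (p. 19)] -/
theorem isMNatConvex_iff (J : Set (σ →₀ ℕ)) :
    IsMNatConvex J ↔ ∃ J' : Set (Option σ →₀ ℕ), IsMConvex J' ∧ Finsupp.some '' J' = J :=
  Iff.rfl

/-- **The homogenization of `J♮` in degree `d`**:
"`J = {(α_1, …, α_n, d - α_1 - ⋯ - α_n) ∈ ℕ^{n+1} | (α_1, …, α_n) ∈ J♮}`", written as the set of `α' ∈ ℕ^{n+1}` of
total degree `d` whose restriction to the first `n` coordinates lies in `J♮`. [cite: BrandenHuh2019, §2.4 proof of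
Lemma 2.21 (p. 20)] -/
def homogenization (d : ℕ) (J : Set (σ →₀ ℕ)) : Set (Option σ →₀ ℕ) :=
  {α' | α'.some ∈ J ∧ α'.degree = d}

/-- Membership in the homogenization. [cite: BrandenHuh2019, §2.4 proof of Lemma 2.21 (p. 20)] -/
theorem mem_homogenization {d : ℕ} {J : Set (σ →₀ ℕ)} {α' : Option σ →₀ ℕ} :
    α' ∈ homogenization d J ↔ α'.some ∈ J ∧ α'.degree = d :=
  Iff.rfl

end Defs

section Degree

variable [Fintype σ]

/-- `|α'| = |α'|_σ| + α'_{n+1}` for `α' ∈ ℕ^{n+1}`. [cite: BrandenHuh2019, §2.4 proof of Lemma 2.21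
("`(α_1, …, α_n, d - α_1 - ⋯ - α_n)`")] -/
theorem degree_eq_degree_some_add (α' : Option σ →₀ ℕ) : α'.degree = α'.some.degree + α' none := by
  rw [Finsupp.degree_eq_sum, Finsupp.degree_eq_sum, Fintype.sum_option, add_comm]
  simp only [Finsupp.some_apply]

/-- `|(α, y)| = |α| + y`. [cite: BrandenHuh2019, §2.4 proof of Lemma 2.21] -/
theorem degree_optionElim (y : ℕ) (α : σ →₀ ℕ) : (α.optionElim y).degree = α.degree + y := by
  rw [degree_eq_degree_some_add, Finsupp.some_optionElim, Finsupp.optionElim_apply_none]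

/-- The lift `(α, d - |α|)` of `α ∈ J♮`, `|α| ≤ d`, lies in the homogenization `J`.
[cite: BrandenHuh2019, §2.4 proof of Lemma 2.21 (p. 20)] -/
theorem optionElim_mem_homogenization {d : ℕ} {J : Set (σ →₀ ℕ)} {α : σ →₀ ℕ} (hα : α ∈ J)
    (hd : α.degree ≤ d) : α.optionElim (d - α.degree) ∈ homogenization d J := by
  refine ⟨?_, ?_⟩
  · rw [Finsupp.some_optionElim]; exact hα
  · rw [degree_optionElim]; omega

/-- "The projection from `J` to `J♮` should be bijective": for `d ≥ sup_{J♮} |α|` the homogenization projects onto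
`J♮`. [cite: BrandenHuh2019, §2.4 (p. 19) and proof of Lemma 2.21 ("Let `d` be any sufficiently large positive
integer")] -/
theorem image_some_homogenization {d : ℕ} {J : Set (σ →₀ ℕ)} (hd : ∀ α ∈ J, α.degree ≤ d) :
    Finsupp.some '' homogenization d J = J := by
  ext α
  constructor
  · rintro ⟨α', hα', rfl⟩
    exact hα'.1
  · intro hα
    exact ⟨_, optionElim_mem_homogenization hα (hd α hα), Finsupp.some_optionElim _ _⟩

omit [Fintype σ] in
/-- `Finsupp.some` commutes with truncated subtraction. [cite: BrandenHuh2019, §2.4 proof of Lemma 2.21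
("`γ - e_{n+1} + e_j`")] -/
theorem some_tsub (f g : Option σ →₀ ℕ) : (f - g).some = f.some - g.some := by
  ext a
  simp only [Finsupp.some_apply, Finsupp.tsub_apply]

omit [Fintype σ] in
/-- **An M-convex set lies in a simplex `Δ^d_n`**: "the M-convexity of `J` implies that `J` is in `Δ^d_n` for some `d`"
— all elements of an M-convex set have the same total degree (induction on `|α - β|`: an exchange step at an index
`i` with `α_i > β_i` lowers it by one and keeps `|α|`). [cite: BrandenHuh2019, §2.4 (p. 19); §2.2 (p. 11, "any
M-convex subset of `ℕ^n` is necessarily contained in the discrete simplex `Δ^d_n` for some `d`")] -/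
theorem IsMConvex.degree_le_degree {τ : Type*} {J : Set (τ →₀ ℕ)} (hJ : IsMConvex J) {α β : τ →₀ ℕ} (hα : α ∈ J)
    (hβ : β ∈ J) : α.degree ≤ β.degree := by
  classical
  obtain ⟨n, hn⟩ : ∃ n, (α - β).degree = n := ⟨_, rfl⟩
  induction n generalizing α with
  | zero =>
    rw [Finsupp.degree_eq_zero_iff, tsub_eq_zero_iff_le] at hn
    obtain ⟨γ, rfl⟩ := exists_add_of_le hn
    rw [map_add]
    exact Nat.le_add_right _ _
  | succ n ih =>
    have hne : α - β ≠ 0 := fun h ↦ by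
      rw [h, map_zero] at hn
      exact Nat.succ_ne_zero n hn.symm
    obtain ⟨i, hi⟩ := Finsupp.ne_iff.1 hne
    have hi0 : (α - β : τ →₀ ℕ) i ≠ 0 := by simpa using hi
    have hi' : β i < α i := by
      rw [Finsupp.tsub_apply] at hi0
      omega
    obtain ⟨j, hj, hmem⟩ := hJ hα hβ i hi'
    have hji : j ≠ i := by
      rintro rfl
      omega
    have heq : α - Finsupp.single i 1 + Finsupp.single j 1 - β = (α - β) - Finsupp.single i 1 := by
      ext k
      simp only [Finsupp.tsub_apply, Finsupp.add_apply]
      by_cases hki : k = i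
      · subst hki
        rw [Finsupp.single_eq_same, Finsupp.single_eq_of_ne hji.symm]
        omega
      · rw [Finsupp.single_eq_of_ne hki]
        by_cases hkj : k = j
        · subst hkj
          rw [Finsupp.single_eq_same]
          omega
        · rw [Finsupp.single_eq_of_ne hkj]
          omega
    have hdeg : (α - Finsupp.single i 1 + Finsupp.single j 1 - β).degree = n := by
      rw [heq]
      have := degree_sub_single_add_one hi0
      omega
    calc α.degree = (α - Finsupp.single i 1 + Finsupp.single j 1).degree :=
          (degree_sub_single_add_single (by omega) j).symm
      _ ≤ β.degree := ih hmem hdeg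

omit [Fintype σ] in
/-- All elements of an M-convex set have the same total degree. [cite: BrandenHuh2019, §2.2 (p. 11); §2.4 (p. 19)] -/
theorem IsMConvex.degree_eq_degree {τ : Type*} {J : Set (τ →₀ ℕ)} (hJ : IsMConvex J) {α β : τ →₀ ℕ} (hα : α ∈ J)
    (hβ : β ∈ J) : α.degree = β.degree :=
  le_antisymm (hJ.degree_le_degree hα hβ) (hJ.degree_le_degree hβ hα)

end Degree

/-! ## §2 Lemma 2.21: for an interval convex `J♮ ∋ 0`, M♮-convexity is the augmentation property -/

section Augmentation

variable [Fintype σ] [DecidableEq σ]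

omit [DecidableEq σ] in
/-- **Lemma 2.21, "if" direction (the one used for Theorem 2.23): the homogenization of an interval convex set
`J♮ ∋ 0` with the augmentation property is M-convex** — "We prove the "if" direction by checking the exchange property
for `J`" (verbatim: the cases `i = n + 1`; `i ≠ n + 1` and `α_{n+1} < β_{n+1}`; `α_{n+1} ≥ β_{n+1}` via
`γ = α - e_i + e_{n+1}`). The statement holds for every `d` (elements of `J♮` of degree `> d` simply have no lift).
[cite: BrandenHuh2019, §2.4 Lemma 2.21 and its proof (pp. 20–21)] -/
theorem isMConvex_homogenization {J : Set (σ →₀ ℕ)} (hI : IsIntervalConvex J) (h0 : (0 : σ →₀ ℕ) ∈ J)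
    (hA : HasAugmentationProperty J) (d : ℕ) : IsMConvex (homogenization d J) := by
  rintro α' β' ⟨hα, hαd⟩ ⟨hβ, hβd⟩ i hi
  have hdα := degree_eq_degree_some_add α'
  have hdβ := degree_eq_degree_some_add β'
  cases i with
  | none =>
    -- `α_{n+1} > β_{n+1}`, i.e. `|α| < |β|`: the augmentation property
    have hlt : α'.some.degree < β'.some.degree := by omega
    obtain ⟨j, hj, hmem⟩ := hA hα hβ hlt
    refine ⟨some j, by simpa only [Finsupp.some_apply] using hj, ?_, ?_⟩
    · have heq : (α' - Finsupp.single none 1 + Finsupp.single (some j) 1).some = α'.some + Finsupp.single j 1 := by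
        rw [Finsupp.some_add, some_tsub, Finsupp.some_single_none, Finsupp.some_single_some, tsub_zero]
      rw [heq]
      exact hmem
    · rw [degree_sub_single_add_single (by omega) (some j)]
      exact hαd
  | some i =>
    have hi' : β'.some i < α'.some i := by simpa only [Finsupp.some_apply] using hi
    have hαi : α'.some i ≠ 0 := by omega
    by_cases hlt : α' none < β' none
    · -- take `j = n + 1`: `α - e_i + e_{n+1}` is the lift of `α|_σ - e_i ∈ J♮` (interval convexity with `0`)
      refine ⟨none, hlt, ?_, ?_⟩
      · have heq : (α' - Finsupp.single (some i) 1 + Finsupp.single none 1).some =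
            α'.some - Finsupp.single i 1 := by
          rw [Finsupp.some_add, some_tsub, Finsupp.some_single_none, Finsupp.some_single_some, add_zero]
        rw [heq]
        exact hI.mem_of_le h0 hα tsub_le_self
      · rw [degree_sub_single_add_single (by rw [← Finsupp.some_apply]; exact hαi) none]
        exact hαd
    · -- `α_{n+1} ≥ β_{n+1}`: `γ = α - e_i + e_{n+1}`, i.e. `γ|_σ = α|_σ - e_i`, and augmentation for `γ|_σ, β|_σ`
      set γ := α'.some - Finsupp.single i 1 with hγdef
      have hγJ : γ ∈ J := hI.mem_of_le h0 hα tsub_le_self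
      have hγdeg : γ.degree + 1 = α'.some.degree := degree_sub_single_add_one hαi
      obtain ⟨j, hj, hmem⟩ := hA hγJ hβ (by omega)
      have hji : j ≠ i := by
        rintro rfl
        rw [hγdef, Finsupp.tsub_apply, Finsupp.single_eq_same] at hj
        omega
      have hj' : α'.some j < β'.some j := by
        rwa [hγdef, Finsupp.tsub_apply, Finsupp.single_eq_of_ne hji, tsub_zero] at hj
      refine ⟨some j, by simpa only [Finsupp.some_apply] using hj', ?_, ?_⟩
      · have heq : (α' - Finsupp.single (some i) 1 + Finsupp.single (some j) 1).some =
            γ + Finsupp.single j 1 := by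
          rw [Finsupp.some_add, some_tsub, Finsupp.some_single_some, Finsupp.some_single_some]
        rw [heq]
        exact hmem
      · rw [degree_sub_single_add_single (by rw [← Finsupp.some_apply]; exact hαi) (some j)]
        exact hαd

omit [DecidableEq σ] in
/-- **Lemma 2.21, "only if" direction**: an M♮-convex set has the augmentation property ("If `J♮` is M♮-convex, then
`J` is M-convex, and the augmentation property for `J♮` is a special case of the exchange property for `J`": lift
`α, β` to `J`; since `J ⊆ Δ^d`, `|α| < |β|` means `α_{n+1} > β_{n+1}`, and an exchange at `n + 1` is an augmentation).
This direction needs neither interval convexity nor `0 ∈ J♮`. [cite: BrandenHuh2019, §2.4 Lemma 2.21 and its proof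
(p. 20)] -/
theorem IsMNatConvex.hasAugmentationProperty {J : Set (σ →₀ ℕ)} (h : IsMNatConvex J) :
    HasAugmentationProperty J := by
  obtain ⟨J', hJ', rfl⟩ := h
  rintro _ _ ⟨α', hα', rfl⟩ ⟨β', hβ', rfl⟩ hlt
  have hdeg := hJ'.degree_eq_degree hα' hβ'
  have hdα := degree_eq_degree_some_add α'
  have hdβ := degree_eq_degree_some_add β'
  have hi : β' none < α' none := by omega
  obtain ⟨j', hj', hmem⟩ := hJ' hα' hβ' none hi
  cases j' with
  | none => exact absurd hj' (lt_asymm hi)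
  | some j =>
    refine ⟨j, by simpa only [Finsupp.some_apply] using hj', _, hmem, ?_⟩
    rw [Finsupp.some_add, some_tsub, Finsupp.some_single_none, Finsupp.some_single_some, tsub_zero]

omit [DecidableEq σ] in
/-- **Brändén–Huh, Lemma 2.21.** "Let `J♮` be an interval convex subset of `ℕ^n` containing `0`. Then `J♮` is
M♮-convex if and only if `J♮` satisfies the augmentation property." Stated for bounded `J♮` (`|α| ≤ d` on `J♮` —
"Let `d` be any sufficiently large positive integer"; the `J♮` of the source are supports of polynomials, hence
bounded. For an unbounded `J♮` such as `ℕ^n` the augmentation property holds while no M-convex, hence finite-degree,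
lift exists). [cite: BrandenHuh2019, §2.4 Lemma 2.21 (p. 20)] -/
theorem isMNatConvex_iff_hasAugmentationProperty {J : Set (σ →₀ ℕ)} (hI : IsIntervalConvex J)
    (h0 : (0 : σ →₀ ℕ) ∈ J) {d : ℕ} (hd : ∀ α ∈ J, α.degree ≤ d) :
    IsMNatConvex J ↔ HasAugmentationProperty J :=
  ⟨fun h ↦ h.hasAugmentationProperty,
    fun hA ↦ ⟨_, isMConvex_homogenization hI h0 hA d, image_some_homogenization hd⟩⟩

end Augmentation

/-! ## §3 Lemma 2.22 (2): the support of a `c`-Rayleigh `f` with `f(0) ≠ 0` has the augmentation property -/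

section AugmentationSupport

variable [Fintype σ] [DecidableEq σ]

omit [DecidableEq σ] in
/-- A single monomial bounds `f(w)` from below on `ℝ^n_{≥0}` when `f` has nonnegative coefficients:
`coeff_δ f · w^δ ≤ f(w)`. [cite: BrandenHuh2019, §2.4 proof of Lemma 2.22 (2) ("`g(w) ∂_j∂_k g(w)` is a strictly
increasing function of `w_i`")] -/
theorem coeff_mul_prod_pow_le_eval {f : MvPolynomial σ ℝ} (hf : ∀ δ, 0 ≤ coeff δ f) {w : σ → ℝ}
    (hw : ∀ k, 0 ≤ w k) (δ : σ →₀ ℕ) : coeff δ f * ∏ k, w k ^ δ k ≤ eval w f := by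
  rw [eval_eq']
  by_cases hδ : δ ∈ f.support
  · exact Finset.single_le_sum (f := fun γ ↦ coeff γ f * ∏ k, w k ^ γ k)
      (fun γ _ ↦ mul_nonneg (hf γ) (Finset.prod_nonneg fun k _ ↦ pow_nonneg (hw k) _)) hδ
  · rw [MvPolynomial.notMem_support_iff.1 hδ, zero_mul]
    exact Finset.sum_nonneg fun γ _ ↦ mul_nonneg (hf γ) (Finset.prod_nonneg fun k _ ↦ pow_nonneg (hw k) _)

/-- If no monomial of `f` involves `w_i`, then `f(w)` does not depend on `w_i` ("`∂_j g(w) ∂_k g(w)` is independent of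
`w_i`"). [cite: BrandenHuh2019, §2.4 proof of Lemma 2.22 (2) (p. 23)] -/
theorem eval_update_eq_of_forall_apply_eq_zero {f : MvPolynomial σ ℝ} {i : σ}
    (hf : ∀ δ, coeff δ f ≠ 0 → δ i = 0) (w : σ → ℝ) (t : ℝ) :
    eval (Function.update w i t) f = eval w f := by
  rw [eval_eq', eval_eq']
  refine Finset.sum_congr rfl fun δ hδ ↦ ?_
  congr 1
  refine Finset.prod_congr rfl fun k _ ↦ ?_
  by_cases hk : k = i
  · subst hk
    rw [hf δ (MvPolynomial.mem_support_iff.1 hδ), pow_zero, pow_zero]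
  · rw [Function.update_of_ne hk]

/-- **The final step of the proof of Lemma 2.22 (2).** If `g` is `c`-Rayleigh with `g(0) ≠ 0` and
`e_i, e_j + e_k ∈ supp(g)` (`i ∉ {j, k}`), then `e_i + e_j ∈ supp(g)` or `e_i + e_k ∈ supp(g)`: otherwise, by the
interval convexity of `supp g` (Lemma 2.22 (1)), no monomial of `∂_j g` or `∂_k g` involves `w_i`, so at
`w_t = (1, …, 1, t, 1, …, 1)` (`t` in place `i`) the right-hand side `c ∂_j g(w_t) ∂_k g(w_t)` of Def. 2.18 is constant,
while `g(w_t) ∂_j∂_k g(w_t) ≥ coeff_{e_i}(g) t · c_{e_j+e_k}(g) → ∞` — "This contradicts the `c`-Rayleigh property of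
`g`". [cite: BrandenHuh2019, §2.4 proof of Lemma 2.22 (2) (pp. 22–23)] -/
theorem coeff_add_single_ne_zero_or_of_isCRayleigh {c : ℝ} {g : MvPolynomial σ ℝ} (h : IsCRayleigh c g)
    (h0 : coeff 0 g ≠ 0) {i j k : σ} (hij : i ≠ j) (hik : i ≠ k) (hi : coeff (Finsupp.single i 1) g ≠ 0)
    (hjk : coeff (Finsupp.single j 1 + Finsupp.single k 1) g ≠ 0) :
    coeff (Finsupp.single i 1 + Finsupp.single j 1) g ≠ 0 ∨ coeff (Finsupp.single i 1 + Finsupp.single k 1) g ≠ 0 := by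
  by_contra hno
  rw [not_or, not_ne_iff, not_ne_iff] at hno
  obtain ⟨hij0, hik0⟩ := hno
  have hnn := h.coeff_nonneg
  -- `∂_l g` (`l = j, k`) has no monomial involving `w_i`, by interval convexity (`e_i + e_l ∉ supp g ∋ 0`)
  have hindep : ∀ {l : σ}, coeff (Finsupp.single i 1 + Finsupp.single l 1) g = 0 →
      ∀ δ, coeff δ (iterPderiv (Finsupp.single l 1) g) ≠ 0 → δ i = 0 := by
    intro l hl0 δ hδ
    rw [coeff_iterPderiv_ne_zero_iff] at hδ
    by_contra hδi
    have hle : Finsupp.single i 1 + Finsupp.single l 1 ≤ Finsupp.single l 1 + δ := by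
      rw [add_comm (Finsupp.single i 1)]
      exact add_le_add le_rfl ((Finsupp.single_le_iff.2 (Nat.pos_of_ne_zero hδi) : Finsupp.single i 1 ≤ δ))
    exact h.coeff_ne_zero_of_le h0 hδ hle hl0
  -- the constants: `a = coeff_{e_i} g > 0`, `b = c_{e_j+e_k}(g) > 0`, `P₀ = ∂_j g(𝟙) ∂_k g(𝟙)`
  have ha : 0 < coeff (Finsupp.single i 1) g := lt_of_le_of_ne (hnn _) (Ne.symm hi)
  have hb : 0 < normCoeff (Finsupp.single j 1 + Finsupp.single k 1) g :=
    normCoeff_pos_iff.2 (lt_of_le_of_ne (hnn _) (Ne.symm hjk))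
  set a := coeff (Finsupp.single i 1) g with hadef
  set b := normCoeff (Finsupp.single j 1 + Finsupp.single k 1) g with hbdef
  set P₀ := eval (fun _ ↦ (1 : ℝ)) (iterPderiv (Finsupp.single j 1) g) *
    eval (fun _ ↦ (1 : ℝ)) (iterPderiv (Finsupp.single k 1) g) with hP₀def
  -- the point `w_t`, `t = |c P₀|/(ab) + 1`
  set t := |c * P₀| / (a * b) + 1 with htdef
  have ht0 : 0 ≤ t := by positivity
  set w : σ → ℝ := Function.update (fun _ ↦ (1 : ℝ)) i t with hwdef
  have hw0 : ∀ l, 0 ≤ w l := by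
    intro l
    by_cases hl : l = i
    · subst hl; rw [hwdef, Function.update_self]; exact ht0
    · rw [hwdef, Function.update_of_ne hl]; exact zero_le_one
  -- Def. 2.18 at `w_t` with `α = 0` and the indices `j`, `k`
  have hR := h.le 0 j k hw0
  simp only [zero_add, iterPderiv_zero] at hR
  rw [eval_update_eq_of_forall_apply_eq_zero (hindep hij0), eval_update_eq_of_forall_apply_eq_zero (hindep hik0)]
    at hR
  -- the left-hand side is at least `a t · b`
  have hL1 : a * t ≤ eval w g := by
    have h1 := coeff_mul_prod_pow_le_eval hnn hw0 (Finsupp.single i 1)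
    have hprod : ∏ l, w l ^ (Finsupp.single i 1 : σ →₀ ℕ) l = t := by
      rw [Finset.prod_eq_single i (fun l _ hl ↦ by rw [Finsupp.single_eq_of_ne hl, pow_zero])
        (fun hi' ↦ (hi' (Finset.mem_univ i)).elim), Finsupp.single_eq_same, pow_one, hwdef, Function.update_self]
    rwa [hprod] at h1
  have hL2 : b ≤ eval w (iterPderiv (Finsupp.single j 1 + Finsupp.single k 1) g) := by
    have h1 := coeff_mul_prod_pow_le_eval (coeff_iterPderiv_nonneg hnn _) hw0 (0 : σ →₀ ℕ)
      (f := iterPderiv (Finsupp.single j 1 + Finsupp.single k 1) g)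
    simp only [Finsupp.coe_zero, Pi.zero_apply, pow_zero, Finset.prod_const_one, mul_one] at h1
    rwa [coeff_zero_iterPderiv] at h1
  have hL : a * t * b ≤ eval w g * eval w (iterPderiv (Finsupp.single j 1 + Finsupp.single k 1) g) :=
    mul_le_mul hL1 hL2 hb.le ((mul_nonneg ha.le ht0).trans hL1)
  -- but `a t b = |c P₀| + a b > c P₀`
  have hgt : c * P₀ < a * t * b := by
    have heq : a * t * b = |c * P₀| + a * b := by
      rw [htdef]
      field_simp
    rw [heq]
    have := le_abs_self (c * P₀)
    nlinarith [mul_pos ha hb]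
  exact absurd (hL.trans hR) (not_le.2 hgt)

/-- **Lemma 2.22 (2), as the augmentation property**: if `f` is `c`-Rayleigh with `f(0) ≠ 0`, then for
`α, β ∈ supp f` with `|α| < |β|` there is `j` with `α_j < β_j` and `α + e_j ∈ supp f`. The printed minimal-counterexample
argument run as a strong induction on `|α| + |β|`: an index in `S(α) ∩ S(β)` is removed by the contraction `∂_i f`;
otherwise `α - e_i ∈ supp f` (interval convexity) augments to some `α - e_i + e_j` (induction), which either answers or,
through the contraction `∂_j f` (induction), augments to some `α - e_i + e_j + e_k`, which either answers or contradicts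
`coeff_add_single_ne_zero_or_of_isCRayleigh` for `g = ∂^{α - e_i} f`. [cite: BrandenHuh2019, §2.4 Lemma 2.22 (2) and its
proof (pp. 21–23)] -/
theorem exists_lt_coeff_add_single_ne_zero_of_isCRayleigh {c : ℝ} {f : MvPolynomial σ ℝ} (h : IsCRayleigh c f)
    (h0 : coeff 0 f ≠ 0) {α β : σ →₀ ℕ} (hα : coeff α f ≠ 0) (hβ : coeff β f ≠ 0) (hlt : α.degree < β.degree) :
    ∃ j, α j < β j ∧ coeff (α + Finsupp.single j 1) f ≠ 0 := by
  obtain ⟨n, hn⟩ : ∃ n, α.degree + β.degree = n := ⟨_, rfl⟩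
  induction n using Nat.strong_induction_on generalizing f α β with
  | _ n ih =>
  by_cases hc : ∃ i, α i ≠ 0 ∧ β i ≠ 0
  · -- an index `i ∈ S(α) ∩ S(β)`: pass to the contraction `∂_i f`
    obtain ⟨i, hαi, hβi⟩ := hc
    have hei : coeff (Finsupp.single i 1) f ≠ 0 :=
      h.coeff_ne_zero_of_le h0 hα (Finsupp.single_le_iff.2 (Nat.pos_of_ne_zero hαi))
    have h0g : coeff 0 (pderiv i f) ≠ 0 := by
      rw [coeff_pderiv_ne_zero_iff, zero_add]; exact hei
    have hαg : coeff (α - Finsupp.single i 1) (pderiv i f) ≠ 0 := by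
      rw [coeff_pderiv_ne_zero_iff, tsub_add_cancel_of_le (Finsupp.single_le_iff.2 (Nat.pos_of_ne_zero hαi))]
      exact hα
    have hβg : coeff (β - Finsupp.single i 1) (pderiv i f) ≠ 0 := by
      rw [coeff_pderiv_ne_zero_iff, tsub_add_cancel_of_le (Finsupp.single_le_iff.2 (Nat.pos_of_ne_zero hβi))]
      exact hβ
    have hdα := degree_sub_single_add_one hαi
    have hdβ := degree_sub_single_add_one hβi
    obtain ⟨j, hj, hmem⟩ := ih _ (by omega) (h.pderiv i) h0g hαg hβg (by omega) rfl
    refine ⟨j, ?_, ?_⟩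
    · rw [Finsupp.tsub_apply, Finsupp.tsub_apply] at hj
      by_cases hji : j = i
      · subst hji
        rw [Finsupp.single_eq_same] at hj
        omega
      · rw [Finsupp.single_eq_of_ne hji, tsub_zero, tsub_zero] at hj
        exact hj
    · rw [coeff_pderiv_ne_zero_iff, add_right_comm,
        tsub_add_cancel_of_le (Finsupp.single_le_iff.2 (Nat.pos_of_ne_zero hαi))] at hmem
      exact hmem
  · -- `S(α) ∩ S(β) = ∅`
    have hdisj : ∀ i, α i ≠ 0 → β i = 0 := fun i hαi ↦ by
      by_contra hβi
      exact hc ⟨i, hαi, hβi⟩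
    by_cases hα0 : α = 0
    · -- `α = 0`: any `e_j ≤ β` is in the support (interval convexity)
      subst hα0
      have hβ0 : β ≠ 0 := by
        rintro rfl
        exact lt_irrefl _ hlt
      obtain ⟨j, hj⟩ := Finsupp.ne_iff.1 hβ0
      have hβj : β j ≠ 0 := by simpa using hj
      refine ⟨j, by simpa using Nat.pos_of_ne_zero hβj, ?_⟩
      rw [zero_add]
      exact h.coeff_ne_zero_of_le h0 hβ (Finsupp.single_le_iff.2 (Nat.pos_of_ne_zero hβj))
    · -- "there is an index `i` in `S(α)`"; `α' = α - e_i ∈ supp f`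
      obtain ⟨i, hi⟩ := Finsupp.ne_iff.1 hα0
      have hαi : α i ≠ 0 := by simpa using hi
      have hβi : β i = 0 := hdisj i hαi
      set α' := α - Finsupp.single i 1 with hα'def
      have hα' : coeff α' f ≠ 0 := h.coeff_ne_zero_of_le h0 hα tsub_le_self
      have hdα' : α'.degree + 1 = α.degree := degree_sub_single_add_one hαi
      have hα'i : α' + Finsupp.single i 1 = α :=
        tsub_add_cancel_of_le (Finsupp.single_le_iff.2 (Nat.pos_of_ne_zero hαi))
      have hα'_apply : ∀ {l : σ}, l ≠ i → α' l = α l := fun {l} hl ↦ by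
        rw [hα'def, Finsupp.tsub_apply, Finsupp.single_eq_of_ne hl, tsub_zero]
      -- augmentation for `(α', β)` ("by the minimality of `|α|_1`")
      obtain ⟨j, hj, hα'j⟩ := ih _ (by omega) h h0 hα' hβ (by omega) rfl
      have hji : j ≠ i := by
        rintro rfl
        rw [hβi] at hj
        exact Nat.not_lt_zero _ hj
      have hαj : α j < β j := by rwa [hα'_apply hji] at hj
      by_cases hαej : coeff (α + Finsupp.single j 1) f ≠ 0
      · exact ⟨j, hαj, hαej⟩
      rw [not_ne_iff] at hαej
      -- augmentation for `(α' + e_j, β)` through the contraction `∂_j f` ("otherwise `∂_j f` is a smaller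
      -- counterexample")
      have hβj : 0 < β j := by omega
      have hej : coeff (Finsupp.single j 1) f ≠ 0 := h.coeff_ne_zero_of_le h0 hβ (Finsupp.single_le_iff.2 hβj)
      have h0g : coeff 0 (pderiv j f) ≠ 0 := by
        rw [coeff_pderiv_ne_zero_iff, zero_add]; exact hej
      have hα'g : coeff α' (pderiv j f) ≠ 0 := by
        rw [coeff_pderiv_ne_zero_iff]; exact hα'j
      have hβg : coeff (β - Finsupp.single j 1) (pderiv j f) ≠ 0 := by
        rw [coeff_pderiv_ne_zero_iff, tsub_add_cancel_of_le (Finsupp.single_le_iff.2 hβj)]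
        exact hβ
      have hdβ := degree_sub_single_add_one hβj.ne'
      obtain ⟨k, hk, hα'k⟩ := ih _ (by omega) (h.pderiv j) h0g hα'g hβg (by omega) rfl
      rw [coeff_pderiv_ne_zero_iff] at hα'k
      have hki : k ≠ i := by
        rintro rfl
        have hz : (β - Finsupp.single j 1 : σ →₀ ℕ) k = 0 := by
          rw [Finsupp.tsub_apply, hβi, zero_tsub]
        rw [hz] at hk
        exact Nat.not_lt_zero _ hk
      have hαk : α k < β k := by
        have h1 : α' k = α k := hα'_apply hki
        have h2 : (β - Finsupp.single j 1 : σ →₀ ℕ) k ≤ β k := by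
          rw [Finsupp.tsub_apply]; exact tsub_le_self
        rw [h1] at hk
        exact lt_of_lt_of_le hk h2
      by_cases hαek : coeff (α + Finsupp.single k 1) f ≠ 0
      · exact ⟨k, hαk, hαek⟩
      rw [not_ne_iff] at hαek
      -- the contradiction for `g = ∂^{α'} f`: `0, e_i, e_j + e_k ∈ supp g`, `e_i + e_j, e_i + e_k ∉ supp g`
      exfalso
      have hG0 : coeff 0 (iterPderiv α' f) ≠ 0 := by
        rw [coeff_iterPderiv_ne_zero_iff, add_zero]; exact hα'
      have hGi : coeff (Finsupp.single i 1) (iterPderiv α' f) ≠ 0 := by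
        rw [coeff_iterPderiv_ne_zero_iff, hα'i]; exact hα
      have hGjk : coeff (Finsupp.single j 1 + Finsupp.single k 1) (iterPderiv α' f) ≠ 0 := by
        rw [coeff_iterPderiv_ne_zero_iff, ← add_assoc, add_right_comm]; exact hα'k
      have hGij : coeff (Finsupp.single i 1 + Finsupp.single j 1) (iterPderiv α' f) = 0 := by
        rw [← not_ne_iff, coeff_iterPderiv_ne_zero_iff, ← add_assoc, hα'i, not_ne_iff]; exact hαej
      have hGik : coeff (Finsupp.single i 1 + Finsupp.single k 1) (iterPderiv α' f) = 0 := by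
        rw [← not_ne_iff, coeff_iterPderiv_ne_zero_iff, ← add_assoc, hα'i, not_ne_iff]; exact hαek
      rcases coeff_add_single_ne_zero_or_of_isCRayleigh (h.iterPderiv α') hG0 (Ne.symm hji) (Ne.symm hki) hGi hGjk
        with h1 | h1
      · exact h1 hGij
      · exact h1 hGik

/-- **Lemma 2.22 (2) (augmentation form): the support of a `c`-Rayleigh polynomial with `f(0) ≠ 0` has the
augmentation property.** [cite: BrandenHuh2019, §2.4 Lemma 2.22 (2) (p. 21)] -/
theorem hasAugmentationProperty_support_of_isCRayleigh {c : ℝ} {f : MvPolynomial σ ℝ} (h : IsCRayleigh c f)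
    (h0 : coeff 0 f ≠ 0) : HasAugmentationProperty {α | coeff α f ≠ 0} :=
  fun _ _ hα hβ hlt ↦ exists_lt_coeff_add_single_ne_zero_of_isCRayleigh h h0 hα hβ hlt

omit [Fintype σ] [DecidableEq σ] in
/-- Exponents in the support of `f` have total degree at most `totalDegree f` (so supports are bounded, as Lemma
2.21 needs). [cite: BrandenHuh2019, §2.4 proof of Lemma 2.21 ("Let `d` be any sufficiently large positive
integer")] -/
theorem degree_le_totalDegree_of_coeff_ne_zero {f : MvPolynomial σ ℝ} {α : σ →₀ ℕ} (hα : coeff α f ≠ 0) :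
    α.degree ≤ f.totalDegree := by
  rw [Finsupp.degree_apply]
  exact le_totalDegree (MvPolynomial.mem_support_iff.2 hα)

/-- **Brändén–Huh, Lemma 2.22 (2).** "If `f(0)` is nonzero, then `supp(f)` is M♮-convex" (for `f` `c`-Rayleigh):
Lemma 2.21 applied to the interval convex (Lemma 2.22 (1)) support with the augmentation property.
[cite: BrandenHuh2019, §2.4 Lemma 2.22 (2) (p. 21)] -/
theorem isMNatConvex_support_of_isCRayleigh {c : ℝ} {f : MvPolynomial σ ℝ} (h : IsCRayleigh c f)
    (h0 : coeff 0 f ≠ 0) : IsMNatConvex {α | coeff α f ≠ 0} :=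
  (isMNatConvex_iff_hasAugmentationProperty (isIntervalConvex_support_of_isCRayleigh h) h0
    (d := f.totalDegree) fun _ hα ↦ degree_le_totalDegree_of_coeff_ne_zero hα).2
    (hasAugmentationProperty_support_of_isCRayleigh h h0)

end AugmentationSupport

/-! ## §4 Theorem 2.23: the support of a homogeneous `c`-Rayleigh polynomial is M-convex -/

section Homogeneous

variable [Fintype σ] [DecidableEq σ]

omit [DecidableEq σ] in
/-- **Taylor coefficients of the translation**: `c_δ(f(w + a)) = (∂^δ f)(a)` — the normalized coefficient of `w^δ` in
`f(a + w)` is the value at `a` of `∂^δ f` (`∂^δ` commutes with translation, Lemma 2.20 (5), and `(∂^δ g)(0) = c_δ(g)`).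
[cite: BrandenHuh2019, §2.4 Lemma 2.20 (5), proof of Thm. 2.23 (the translation `g(w) = f(w + 𝟙)`)] -/
theorem normCoeff_translate (a : σ → ℝ) (δ : σ →₀ ℕ) (f : MvPolynomial σ ℝ) :
    normCoeff δ (translate a f) = eval a (iterPderiv δ f) := by
  rw [← coeff_zero_iterPderiv, iterPderiv_translate, ← eval_zero_eq_coeff_zero, eval_translate]
  simp only [zero_add]

omit [DecidableEq σ] in
/-- **The support of `g(w) = f(w + 𝟙)`** for `f` with nonnegative coefficients: `δ ∈ supp g` iff `δ ≤ γ` for some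
`γ ∈ supp f` (by `c_δ(g) = (∂^δ f)(𝟙) = Σ_β coeff_β(∂^δ f) ≥ 0`). [cite: BrandenHuh2019, §2.4 proof of Thm. 2.23
("the support of the translation `g`")] -/
theorem coeff_translate_one_ne_zero_iff {f : MvPolynomial σ ℝ} (hf : ∀ β, 0 ≤ coeff β f) (δ : σ →₀ ℕ) :
    coeff δ (translate (fun _ ↦ (1 : ℝ)) f) ≠ 0 ↔ ∃ γ, δ ≤ γ ∧ coeff γ f ≠ 0 := by
  rw [Ne, ← normCoeff_eq_zero_iff, normCoeff_translate, eval_const_eq_sum]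
  simp only [one_pow, mul_one]
  constructor
  · intro hsum
    obtain ⟨β, _, hne⟩ := Finset.exists_ne_zero_of_sum_ne_zero hsum
    exact ⟨δ + β, le_self_add, (coeff_iterPderiv_ne_zero_iff δ β f).1 hne⟩
  · rintro ⟨γ, hle, hγ⟩
    obtain ⟨β, rfl⟩ := exists_add_of_le hle
    have hβ : coeff β (iterPderiv δ f) ≠ 0 := (coeff_iterPderiv_ne_zero_iff δ β f).2 hγ
    exact (Finset.sum_pos' (fun x _ ↦ coeff_iterPderiv_nonneg hf δ x)
      ⟨β, MvPolynomial.mem_support_iff.2 hβ, lt_of_le_of_ne (coeff_iterPderiv_nonneg hf δ β) hβ.symm⟩).ne'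

omit [Fintype σ] in
/-- **Pulling an M-convex set back from `ℕ^{n+1}` along `α ↦ (α, 0)`** gives an M-convex set (the identification of the
coordinate hyperplane `α_{n+1} = 0` of `ℕ^{n+1}` with `ℕ^n`). [cite: BrandenHuh2019, §2.4 proof of Thm. 2.23 ("the
intersection of an M-convex set with a coordinate hyperplane is M-convex")] -/
theorem IsMConvex.comap_optionElim_zero {J' : Set (Option σ →₀ ℕ)} (hJ : IsMConvex J') :
    IsMConvex {α : σ →₀ ℕ | α.optionElim 0 ∈ J'} := by
  classical
  intro α β hα hβ i hi
  have hi' : (β.optionElim 0) (some i) < (α.optionElim 0) (some i) := by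
    simpa only [Finsupp.optionElim_apply_some] using hi
  obtain ⟨j', hj', hmem⟩ := hJ hα hβ (some i) hi'
  cases j' with
  | none => simp only [Finsupp.optionElim_apply_none, lt_self_iff_false] at hj'
  | some j =>
    refine ⟨j, by simpa only [Finsupp.optionElim_apply_some] using hj', ?_⟩
    have heq : (α - Finsupp.single i 1 + Finsupp.single j 1).optionElim 0 =
        α.optionElim 0 - Finsupp.single (some i) 1 + Finsupp.single (some j) 1 := by
      ext o
      cases o with
      | none =>
        rw [Finsupp.optionElim_apply_none, Finsupp.add_apply, Finsupp.tsub_apply, Finsupp.optionElim_apply_none,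
          Finsupp.single_eq_of_ne (Option.some_ne_none i).symm, Finsupp.single_eq_of_ne (Option.some_ne_none j).symm]
        rfl
      | some l =>
        simp only [Finsupp.optionElim_apply_some, Finsupp.add_apply, Finsupp.tsub_apply, Finsupp.single_apply,
          Option.some_inj]
    show (α - Finsupp.single i 1 + Finsupp.single j 1).optionElim 0 ∈ J'
    rw [heq]
    exact hmem

/-- **Brändén–Huh, Theorem 2.23: "If `f` is homogeneous and `c`-Rayleigh, then the support of `f` is M-convex."**
The printed proof: the translation `g(w) = f(w + 𝟙)` is `c`-Rayleigh (Lemma 2.20 (5)) with `g(0) = f(𝟙) ≠ 0`, so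
`supp g` is interval convex with the augmentation property (Lemma 2.22) and its homogenization `J ⊆ ℕ^{n+1}` in
degree `d = deg f` is M-convex (Lemma 2.21); the face `α_{n+1} = 0` of `J` consists of the `(α, 0)` with `|α| = d`
and `α ∈ supp g`, i.e. (`supp g = ⋃_{γ ∈ supp f} [0, γ]`, `f` homogeneous) with `α ∈ supp f`; faces of M-convex sets
are M-convex (`IsMConvex.sep_apply_eq_zero`). (No positivity of `c` is used.) [cite: BrandenHuh2019, §2.4 Theorem
2.23 and its proof (p. 23)] -/
theorem isMConvex_support_of_isCRayleigh {c : ℝ} {f : MvPolynomial σ ℝ} (h : IsCRayleigh c f) {d : ℕ}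
    (hf : f.IsHomogeneous d) : IsMConvex {α | coeff α f ≠ 0} := by
  by_cases hf0 : f = 0
  · subst hf0
    have he : {α : σ →₀ ℕ | coeff α (0 : MvPolynomial σ ℝ) ≠ 0} = ∅ := by
      ext α; simp
    rw [he]
    exact isMConvex_empty
  -- the translation `g(w) = f(w + 𝟙)` and its support
  set g := translate (fun _ ↦ (1 : ℝ)) f with hgdef
  have hg : IsCRayleigh c g := h.translate fun _ ↦ zero_le_one
  have hsupp : ∀ δ, coeff δ g ≠ 0 ↔ ∃ γ, δ ≤ γ ∧ coeff γ f ≠ 0 := fun δ ↦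
    coeff_translate_one_ne_zero_iff h.coeff_nonneg δ
  have hg0 : coeff 0 g ≠ 0 := by
    obtain ⟨γ, hγ⟩ : ∃ γ, coeff γ f ≠ 0 := by
      by_contra hno
      apply hf0
      ext γ
      rw [coeff_zero]
      by_contra hγ
      exact hno ⟨γ, hγ⟩
    exact (hsupp 0).2 ⟨γ, bot_le, hγ⟩
  -- the homogenization of `supp g` is M-convex (Lemma 2.22 (1), (2), Lemma 2.21), and so is its face `α_{n+1} = 0`
  have hJ : IsMConvex (homogenization d {δ | coeff δ g ≠ 0}) :=
    isMConvex_homogenization (isIntervalConvex_support_of_isCRayleigh hg) hg0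
      (hasAugmentationProperty_support_of_isCRayleigh hg hg0) d
  have hJ0 := hJ.sep_apply_eq_zero {none}
  -- that face, pulled back to `ℕ^n`, is `supp f`
  have hset : {α : σ →₀ ℕ | coeff α f ≠ 0} = {α : σ →₀ ℕ | α.optionElim 0 ∈
      {α' | α' ∈ homogenization d {δ | coeff δ g ≠ 0} ∧ ∀ o ∈ ({none} : Set (Option σ)), α' o = 0}} := by
    ext α
    simp only [Set.mem_setOf_eq, mem_homogenization, Finsupp.some_optionElim, Set.mem_singleton_iff, forall_eq,
      Finsupp.optionElim_apply_none, and_true, degree_optionElim, add_zero]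
    constructor
    · intro hα
      refine ⟨(hsupp α).2 ⟨α, le_rfl, hα⟩, ?_⟩
      by_contra hd
      exact hα (hf.coeff_eq_zero hd)
    · rintro ⟨hαg, hdeg⟩
      obtain ⟨γ, hle, hγ⟩ := (hsupp α).1 hαg
      have hγd : γ.degree = d := by
        by_contra hd
        exact hγ (hf.coeff_eq_zero hd)
      obtain ⟨β, rfl⟩ := exists_add_of_le hle
      have hβ : β = 0 := by
        rw [map_add] at hγd
        rw [← Finsupp.degree_eq_zero_iff]
        omega
      rw [hβ, add_zero] at hγ
      exact hγ
  rw [hset]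
  exact hJ0.comap_optionElim_zero

/-- **Theorem 2.23 for a polynomial with nonzero constant term is Lemma 2.22 (2); for a homogeneous one, its support
lies in the simplex `Δ^d_n`**: the M-convex support of a homogeneous `c`-Rayleigh `f ≠ 0` determines the degree.
[cite: BrandenHuh2019, §2.4 Theorem 2.23; §2.2 (p. 11, "contained in the discrete simplex `Δ^d_n`")] -/
theorem IsCRayleigh.degree_eq_of_coeff_ne_zero {c : ℝ} {f : MvPolynomial σ ℝ} (h : IsCRayleigh c f) {d : ℕ}
    (hf : f.IsHomogeneous d) {α β : σ →₀ ℕ} (hα : coeff α f ≠ 0) (hβ : coeff β f ≠ 0) : α.degree = β.degree :=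
  (isMConvex_support_of_isCRayleigh h hf).degree_eq_degree hα hβ

end Homogeneous

end Literature.Combinatorics.LorentzianPolynomials

end
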